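import Summits.BirchSwinnertonDyer.BirchSwinnertonDyer.Theses.PAdicOrderV2
import Literature.NumberTheory.EllipticCurves.PAdicBSD
import Literature.NumberTheory.EllipticCurves.KatoRankBoundSelmerProofs
import Literature.NumberTheory.EllipticCurves.IwasawaSelmerDualProofs
import Literature.NumberTheory.EllipticCurves.IwasawaSelmerModuleFiniteProofs
import Literature.NumberTheory.EllipticCurves.SelmerCorankHolds

/-!
# What crux #2 `PAdicOrderComparisonR2` costs: with Kato's divisibility it bounds every ordinary
# Selmer corank by the analytic rank (line `Sketch`, lead c4 — helper file, `--supports stmt-BirchSwinnertonDyer-0489`)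

A NECESSITY statement for the planners (the direction opposite to the line's reduction). Route
PAdicOrderV2 now carries Kato's divisibility as crux #8 `KatoDivisibility` (stmt-BirchSwinnertonDyer-18082,
a THEOREM in print: Kato, Astérisque 295, Thm 17.4 (1)–(2), at every odd good ordinary prime). Kato's
divisibility alone gives `corank_{ℤ_p} Sel_{p^∞}(E/ℚ) ≤ ord_{T=0} L_p(E,T)` (Thm 18.4; in tree:
`corank Sel ≤ rank_{ℤ_p} X/TX ≤ ord_T g ≤ ord_T ι g = ord_T L_p`). Hence IF crux #2 holds
(`ord_{T=0} L_p(E,T) = r_an`), then at every odd good ordinary prime `p` of every modular `E/ℚ`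

  `rank E(ℚ) + corank_{ℤ_p} Ш(E/ℚ)[p^∞] = corank_{ℤ_p} Sel_{p^∞}(E/ℚ) ≤ ord_{s=1} L(E,s)`,

i.e. crux #2 ∧ crux #8 contain the BSD inequality `rank E(ℚ) ≤ r_an` for every curve with one odd
good ordinary prime (all curves: `exists_good_ordinary_prime_holds`) AND the bound
`corank Ш[p^∞] ≤ r_an - rank` at every odd good ordinary `p` — in particular finiteness-strength
control of `Ш[p^∞]` at a density-one set of primes whenever `rank = r_an`. So no restriction of the
prime (`p ≠ 2`, `5 ≤ p`) makes crux #2 cheap: its upper-bound half is of BSD strength at every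
prime it keeps. (The lower-bound half `r_an ≤ ord` is Kato ∧ route SelmerRank's items, see
`…OfItems.lean`.)

* `selmerCorank_le_order_of_katoDivisibility_at` — the pointwise Kato step from the item's shape
  (membership form `g ∈ char_Λ X`, `ι g = p^n L_p`) on one cyclotomic datum;
* `selmerCorank_le_analyticRank_of_comparison_of_katoDivisibility` — crux #2 → crux #8 →
  `corank Sel_{p^∞} ≤ r_an` at every odd good ordinary `p` (given the newform);
* `rank_add_shaCorank_le_analyticRank_of_comparison_of_katoDivisibility` — the same through the
  Kummer identity `corank Sel = rank + corank Ш[p^∞]` (`selmerCorank_eq_mordellWeilRank_add_holds`).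

References: K. Kato, Astérisque 295 (2004), Thm 17.4 (p. 273), Thm 18.4 (p. 281); R. Greenberg,
LNM 1716 (1999), §1 p. 63 and §3 Lemma 3.1.
-/

-- the problem directory `BirchSwinnertonDyer/BirchSwinnertonDyer` forces the duplicated namespace segment
set_option linter.dupNamespace false

namespace Summit.BirchSwinnertonDyer.BirchSwinnertonDyer.Theorems

open Literature.NumberTheory.EllipticCurves

/-- **Kato's step Thm 17.4 ⇒ Thm 18.4 on one cyclotomic datum, from the shape of crux #8.** For
`E/ℚ` (globally minimal `W`), a prime `p`, a cyclotomic `κ` with topological generator `γ`, a dual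
datum `D` with `X = D.X` torsion, and `g ∈ char_Λ X` with `ι g = p^n · L` for a power series
`L ∈ ℚ_p⟦T⟧`: `corank_{ℤ_p} Sel_{p^∞}(E/ℚ) ≤ ord_T L`. Chain: `corank Sel ≤ rank_{ℤ_p} X/TX`
(`WeierstrassCurve.selmerCorank_le_coinvariantsRank`; `X` is finitely generated over `Λ`,
`SelmerDualData.module_finite_of_isCyclotomic`) `≤ ord_T g`
(`IwasawaAlgebra.coinvariantsRank_le_order_of_mem_charIdeal`) `≤ ord_T ι g = ord_T L`.
[cite: Kato2004Asterisque, Thm. 18.4 (p. 281)] -/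
theorem selmerCorank_le_order_of_katoDivisibility_at :
    ∀ (W : WeierstrassCurve ℚ) [W.IsElliptic] [W.IsGloballyMinimal] (p : ℕ) [Fact p.Prime]
      {κ : Literature.NumberTheory.EllipticCurves.ZpExtension ℚ p} {γ : Field.absoluteGaloisGroup ℚ},
      κ.IsCyclotomic → κ.IsTopGenerator γ → ∀ (D : W.SelmerDualData κ γ), D.IsTorsion →
      ∀ {g : Literature.NumberTheory.EllipticCurves.IwasawaAlgebra p} {n : ℕ} {L : PowerSeries ℚ_[p]},
        g ∈ D.charIdeal →
        Literature.NumberTheory.EllipticCurves.iwasawaToPowerSeries p g =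
          PowerSeries.C ((p : ℚ_[p]) ^ n) * L →
        (W.selmerCorank p : ℕ∞) ≤ L.order := by
  intro W _ _ p _ κ γ hκ hγ D htors g n L hg hι
  haveI : Module.Finite (IwasawaAlgebra p) D.X := D.module_finite_of_isCyclotomic W κ hκ hγ
  -- `corank Sel ≤ rank X/TX ≤ ord g`
  have h0 : (W.selmerCorank p : ℕ∞) ≤ (IwasawaAlgebra.coinvariantsRank p D.X : ℕ∞) := by
    exact_mod_cast W.selmerCorank_le_coinvariantsRank hγ D
  have h1 : (W.selmerCorank p : ℕ∞) ≤ PowerSeries.order g :=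
    h0.trans (IwasawaAlgebra.coinvariantsRank_le_order_of_mem_charIdeal D.X htors g hg)
  -- `ord g ≤ ord (ι g)` (coefficientwise `ℤ_p → ℚ_p`)
  have h2 : PowerSeries.order g ≤ PowerSeries.order (iwasawaToPowerSeries p g) :=
    PowerSeries.le_order_map _
  -- `ord (ι g) = ord (p^n L) = ord L`
  have hpn : IsUnit (PowerSeries.C ((p : ℚ_[p]) ^ n)) := by
    refine IsUnit.map PowerSeries.C (IsUnit.mk0 _ (pow_ne_zero n ?_))
    exact_mod_cast (Fact.out : p.Prime).ne_zero
  have h3 : PowerSeries.order (iwasawaToPowerSeries p g) = L.order := by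
    rw [hι, PowerSeries.order_mul, PowerSeries.order_zero_of_unit hpn, zero_add]
  exact h3 ▸ h1.trans h2

/-- **Crux #2 and crux #8 bound every odd ordinary Selmer corank by the analytic rank.** If
`PAdicOrderComparisonR2` (stmt-0489: `ord_{T=0} L_p(E,T) = r_an` at every good ordinary `p`) and
`KatoDivisibility` (stmt-18082: Kato, Thm 17.4 (1)–(2) at every odd good ordinary `p`), then for
`E/ℚ` (globally minimal `W`) with a newform `f`, at every ODD good ordinary prime `p`:
`corank_{ℤ_p} Sel_{p^∞}(E/ℚ) ≤ ord_{s=1} L(E,s)` — Kato's `corank Sel ≤ ord_T L_p`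
(`selmerCorank_le_order_of_katoDivisibility_at` on a cyclotomic datum, which exists:
`exists_isCyclotomic_isTopGenerator_isCyclotomicVariable_holds`, `nonempty_selmerDualData_holds`)
followed by the crux. [cite: Kato2004Asterisque, Thm. 18.4 (p. 281)] -/
theorem selmerCorank_le_analyticRank_of_comparison_of_katoDivisibility :
    Summit.BirchSwinnertonDyer.BirchSwinnertonDyer.Theses.PAdicOrderV2.PAdicOrderComparisonR2 →
    Summit.BirchSwinnertonDyer.BirchSwinnertonDyer.Theses.PAdicOrderV2.KatoDivisibility →
    ∀ (W : WeierstrassCurve ℚ) [W.IsElliptic] [W.IsGloballyMinimal] (p : ℕ) [Fact p.Prime],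
      p ≠ 2 → Literature.NumberTheory.EllipticCurves.IsOrdinaryAt W p →
      ∀ {N : ℕ} [NeZero N] (f : CuspForm (CongruenceSubgroup.Gamma0 N) 2),
        Literature.NumberTheory.EllipticCurves.ModularForms.IsNewformOf W f →
          W.selmerCorank p ≤ W.analyticRank := by
  intro h2 hK W _ _ p _ hp2 hord N _ f hf
  obtain ⟨κ, hκ, γ, hγ, hγ'⟩ := exists_isCyclotomic_isTopGenerator_isCyclotomicVariable_holds p
  obtain ⟨D⟩ := W.nonempty_selmerDualData_holds κ γ hγ
  obtain ⟨htors, n, g, hg, hι⟩ := hK W p hp2 hord κ γ hκ hγ hγ' f hf D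
  have h := selmerCorank_le_order_of_katoDivisibility_at W p hκ hγ D htors hg hι
  rw [h2 W p hord f hf] at h
  exact_mod_cast h

/-- **Crux #2 ∧ crux #8 ⇒ `rank E(ℚ) + corank_{ℤ_p} Ш(E/ℚ)[p^∞] ≤ ord_{s=1} L(E,s)` at every odd
good ordinary `p`** (Kummer identity `corank Sel_{p^∞} = rank + corank Ш[p^∞]`,
`WeierstrassCurve.selmerCorank_eq_mordellWeilRank_add_holds`): the BSD inequality `rank ≤ r_an`
together with a bound on `Ш[p^∞]` at every odd good ordinary prime — the price of any proof of
crux #2, whatever the restriction on `p`. [cite: GreenbergLNM1716, §1 p. 63] -/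
theorem rank_add_shaCorank_le_analyticRank_of_comparison_of_katoDivisibility :
    Summit.BirchSwinnertonDyer.BirchSwinnertonDyer.Theses.PAdicOrderV2.PAdicOrderComparisonR2 →
    Summit.BirchSwinnertonDyer.BirchSwinnertonDyer.Theses.PAdicOrderV2.KatoDivisibility →
    ∀ (W : WeierstrassCurve ℚ) [W.IsElliptic] [W.IsGloballyMinimal] (p : ℕ) [Fact p.Prime],
      p ≠ 2 → Literature.NumberTheory.EllipticCurves.IsOrdinaryAt W p →
      ∀ {N : ℕ} [NeZero N] (f : CuspForm (CongruenceSubgroup.Gamma0 N) 2),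
        Literature.NumberTheory.EllipticCurves.ModularForms.IsNewformOf W f →
          W.mordellWeilRank + W.shaCorank p ≤ W.analyticRank := by
  intro h2 hK W _ _ p _ hp2 hord N _ f hf
  rw [← W.selmerCorank_eq_mordellWeilRank_add_holds p]
  exact selmerCorank_le_analyticRank_of_comparison_of_katoDivisibility h2 hK W p hp2 hord f hf

end Summit.BirchSwinnertonDyer.BirchSwinnertonDyer.Theorems
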